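import Summits.ABC.IUTFork.Charitable.Thm311D1PerPlaceSepKit
import HarnessLib

/-!
# Branch D, team D1 — KIT II for the per-place/uniform separation INSIDE THE SUB-PACKETS: separable signs

Record file (D-0012; abc-iut cell, rung LADDER-ABC:A2.D; abc-iut-D1-prv gen 2; answers attack (α) on the anchor-R1 certificate
`Charitable/Thm311D1PerPlaceSeparation.lean` p435474: there the separating q-datum leaves the sub-packet `∏_j 𝓘^ℚ(^{S^±_{j+1},j};𝒟⊢_v)`
because the (Ind1) capsule swap moves the `α = j` factor). TAKES NO SIDE on [IUTchIII] Cor. 3.12 or on any author; NO `Prop` fact; one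
bookkeeping predicate and one (Ind2)-family on the FROZEN carrier over abc-iut-w4-d026's index-generic sign shells; everything else a theorem.
* `SepSignedAt Φ j v_ℚ` — refinement of Kit I's `PermSignedAt`: every element `Φ` of ⟨(Ind1)∪(Ind2)⟩ acts on the tuple coordinates of the
  packet `(j, v_ℚ)` by ONE capsule permutation `τ` and a sign that is a PRODUCT OVER THE TENSOR FACTORS of signs depending only on the factor
  and the place read, `ε(w) = ∏_i e_i(w_i)` (`sepSignedAt_of_mem_closure`, closure induction: (Ind1) = capsule permutation + one sign per
  (factor, place) from the strip automorphisms; (Ind2) = one sign per (factor, summand), «independent copies of Ism … on each of the direct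
  summands of the j+1 factors», S. Mochizuki, *Inter-universal Teichmüller theory III*, kurims (May 2020), Thm. 3.11 (i) (Ind2), p. 154).
* `negSummandFamily x` — the (Ind2)-family acting by `−1` on the summand `x` of the tensor factor `0` and trivially elsewhere
  (`negSummandFamily_mem_Ind2Family`); its action on tuple coordinates (`coordTuple_negSummandFamily`); it PRESERVES the sub-packets of the
  one-factor theta vectors (`negSummandFamily_thetaVec1_mem_subPacket`).
* `sign_ratio` — the one computation the separation needs: if `Φ` carries `±θ_{u,j}` to a vector `t₀` whose tuple coordinates along
  «factor 0 at `b`, the rest at `u`» and «everything at `u`» are `c_b·q^{j²}` and `c_a·q^{j²}`, then `e_0(b)·c_a = e_0(u)·c_b`.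
[claim: Mochizuki2012, status: disputed] (node texts) Standard axioms; elementary bookkeeping on the typed carrier; typed ≠ proved.
-/

noncomputable section

open Set
open scoped TensorProduct

namespace Summit.ABC.IUTFork.Charitable

open Thm311 Cor312 Cor312Vol Literature.IUT.LogThetaLattice

variable {T : ThetaIndex}

/-! ## 1. Separable signs: every element of ⟨(Ind1)∪(Ind2)⟩ acts on tuple coordinates by a capsule permutation and a product of per-factor, per-place signs -/

/-- `Φ` acts on the tuple coordinates of the packet `(j, v_ℚ)` by ONE capsule permutation `τ` and the sign `∏_i e i (w i)`, with `e i`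
a `±1`-valued function of the PLACE read in the factor `i` (typed on all of `𝕍`, evaluated at places over `v_ℚ`). Bookkeeping predicate.
[folklore] -/
def SepSignedAt (Φ : (NaiveProv.signShells T).PacketAut) (j : T.Label) (vQ : T.VQ) : Prop :=
  ∃ τ : Equiv.Perm (T.Caps j), ∃ e : T.Caps j → T.V → ℚ, (∀ i y, |e i y| = 1) ∧
    ∀ (w : T.Caps j → T.Fibre vQ) t,
      coordTuple j vQ w (Φ j vQ t) = (∏ i, e i (w i).1) * coordTuple j vQ (fun i => w (τ i)) t

/-- (Ind2)-families: identity permutation, one sign per (factor, summand). [folklore] -/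
theorem sepSignedAt_of_mem_Ind2Family {Φ : (NaiveProv.signShells T).PacketAut}
    (h : Φ ∈ (NaiveProv.signShells T).Ind2Family) (j : T.Label) (vQ : T.VQ) : SepSignedAt Φ j vQ := by
  classical
  obtain ⟨g, hg, hΦ⟩ := h j vQ
  choose s hs hgs using fun i (x : T.Fibre vQ) => Cor312.IdentifiedNonVacuity.exists_eq_mul_of_mem_signs (hg i x)
  let e : T.Caps j → T.V → ℚ := fun i y => if hy : T.over y = vQ then s i ⟨y, hy⟩ else 1
  have he_eval : ∀ i (x : T.Fibre vQ), e i x.1 = s i x := fun i x => by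
    obtain ⟨y, hy⟩ := x
    simp only [e, dif_pos hy]
  refine ⟨Equiv.refl _, e, fun i y => ?_, fun w => ?_⟩
  · simp only [e]
    split_ifs
    · exact hs _ _
    · exact abs_one
  refine eq_mul_of_tprod ((coordTuple j vQ w).comp (Φ j vQ).toLinearMap) (coordTuple j vQ fun i => w (Equiv.refl _ i))
    _ fun y => ?_
  have hL : coordTuple j vQ w (Φ j vQ ((NaiveProv.signShells T).tprod j vQ y)) = ∏ i, s i (w i) * y i (w i) := by
    rw [hΦ, LogShells.factorwise_summandwise_tprod]
    show coordTuple j vQ w (PiTensorProduct.tprod ℚ fun i v => g i v (y i v)) = _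
    rw [coordTuple_tprod]
    exact Finset.prod_congr rfl fun i _ => hgs i _ _
  have hR : coordTuple j vQ (fun i => w (Equiv.refl _ i)) (PiTensorProduct.tprod ℚ y) = ∏ i, y i (w i) :=
    coordTuple_tprod _ _ _ _
  show coordTuple j vQ w (Φ j vQ ((NaiveProv.signShells T).tprod j vQ y)) =
    (∏ i, e i (w i).1) * coordTuple j vQ (fun i => w (Equiv.refl _ i)) (PiTensorProduct.tprod ℚ y)
  rw [hL, hR, ← Finset.prod_mul_distrib]
  exact Finset.prod_congr rfl fun i _ => by rw [he_eval]

/-- (Ind1)-families: the procession's capsule permutation, one sign per (factor, place). [folklore] -/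
theorem sepSignedAt_of_mem_Ind1Family {Φ : (NaiveProv.signShells T).PacketAut}
    (h : Φ ∈ (NaiveProv.signShells T).Ind1Family) (j : T.Label) (vQ : T.VQ) : SepSignedAt Φ j vQ := by
  obtain ⟨σ, g, hg, hΦ⟩ := h j
  have hΦ' : Φ j vQ = ((NaiveProv.signShells T).permute j vQ σ).trans
      ((NaiveProv.signShells T).factorwise j vQ fun i =>
        (NaiveProv.signShells T).summandwise vQ fun v => g i v.1) := hΦ vQ
  choose s hs hgs using fun i (y : T.V) => Cor312.IdentifiedNonVacuity.exists_eq_mul_of_mem_signs (hg i y)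
  refine ⟨σ, s, hs, fun w => ?_⟩
  refine eq_mul_of_tprod ((coordTuple j vQ w).comp (Φ j vQ).toLinearMap) (coordTuple j vQ fun i => w (σ i)) _ fun y => ?_
  show coordTuple j vQ w (Φ j vQ ((NaiveProv.signShells T).tprod j vQ y)) = _
  rw [hΦ', LinearEquiv.trans_apply, LogShells.permute_tprod, LogShells.factorwise_summandwise_tprod]
  have hL : coordTuple j vQ w ((NaiveProv.signShells T).tprod j vQ fun i (v : T.Fibre vQ) =>
      g i v.1 ((fun i => y (σ.symm i)) i v)) = ∏ i, s i (w i).1 * y (σ.symm i) (w i) := by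
    show coordTuple j vQ w (PiTensorProduct.tprod ℚ fun i (v : T.Fibre vQ) => g i v.1 (y (σ.symm i) v)) = _
    rw [coordTuple_tprod]
    exact Finset.prod_congr rfl fun i _ => hgs i _ _
  have hR : coordTuple j vQ (fun i => w (σ i)) (PiTensorProduct.tprod ℚ y) = ∏ i, y i (w (σ i)) :=
    coordTuple_tprod _ _ _ _
  rw [hL, Finset.prod_mul_distrib]
  calc (∏ i, s i (w i).1) * ∏ i, y (σ.symm i) (w i)
      = (∏ i, s i (w i).1) * ∏ k, y (σ.symm (σ k)) (w (σ k)) := by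
        rw [← Equiv.prod_comp σ (fun i => y (σ.symm i) (w i))]
    _ = (∏ i, s i (w i).1) * ∏ k, y k (w (σ k)) := by simp only [Equiv.symm_apply_apply]
    _ = (∏ i, s i (w i).1) * coordTuple j vQ (fun i => w (σ i)) (PiTensorProduct.tprod ℚ y) :=
        congrArg (fun z : ℚ => (∏ i, s i (w i).1) * z) hR.symm

/-- A product of `±1`'s times itself is `1`. [folklore] -/
theorem prod_mul_self_eq_one {ι : Type} [Fintype ι] {a : ι → ℚ} (ha : ∀ i, |a i| = 1) : (∏ i, a i) * ∏ i, a i = 1 := by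
  rw [← Finset.prod_mul_distrib]
  exact Finset.prod_eq_one fun i _ => NaiveProv.mul_self_of_abs_eq_one (ha i)

/-- **Separable signs for the whole indeterminacy group** ⟨(Ind1)∪(Ind2)⟩ (closure induction; products: `e i := e₁ i · e₂ (τ₁⁻¹ i)`,
inverses: `e i := e₁ (τ₁ i)`). [folklore] -/
theorem sepSignedAt_of_mem_closure {Φ : (NaiveProv.signShells T).PacketAut}
    (h : Φ ∈ Subgroup.closure ((NaiveProv.signShells T).Ind1Family ∪ (NaiveProv.signShells T).Ind2Family))
    (j : T.Label) (vQ : T.VQ) : SepSignedAt Φ j vQ := by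
  induction h using Subgroup.closure_induction with
  | mem Ψ hΨ =>
    rcases hΨ with h1 | h2
    · exact sepSignedAt_of_mem_Ind1Family h1 j vQ
    · exact sepSignedAt_of_mem_Ind2Family h2 j vQ
  | one =>
    refine ⟨Equiv.refl _, fun _ _ => 1, fun _ _ => abs_one, fun w t => ?_⟩
    simp only [Pi.one_apply, LinearEquiv.one_eq_refl, LinearEquiv.refl_apply, Equiv.refl_apply, Finset.prod_const_one,
      one_mul]
  | mul Ψ Ψ' _ _ hΨ hΨ' =>
    obtain ⟨τ, e, he, hw⟩ := hΨ
    obtain ⟨τ', e', he', hw'⟩ := hΨ'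
    refine ⟨τ * τ', fun i y => e i y * e' (τ.symm i) y, fun i y => by rw [abs_mul, he, he', one_mul], fun w t => ?_⟩
    simp only [Pi.mul_apply, LinearEquiv.mul_apply, Equiv.Perm.mul_apply]
    rw [hw, hw', ← mul_assoc, Finset.prod_mul_distrib]
    congr 2
    rw [← Equiv.prod_comp τ (fun i => e' (τ.symm i) (w i).1)]
    simp only [Equiv.symm_apply_apply]
  | inv Ψ _ hΨ =>
    obtain ⟨τ, e, he, hw⟩ := hΨ
    refine ⟨τ.symm, fun i y => e (τ i) y, fun i y => he _ _, fun w t => ?_⟩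
    simp only [Pi.inv_apply, LinearEquiv.coe_inv]
    have h1 := hw (fun i => w (τ.symm i)) ((Ψ j vQ).symm t)
    rw [LinearEquiv.apply_symm_apply] at h1
    simp only [Equiv.symm_apply_apply] at h1
    have hE : (∏ i, e i (w (τ.symm i)).1) = ∏ i, e (τ i) (w i).1 := by
      rw [← Equiv.prod_comp τ (fun i => e i (w (τ.symm i)).1)]
      simp only [Equiv.symm_apply_apply]
    have hEE : (∏ i, e (τ i) (w i).1) * ∏ i, e (τ i) (w i).1 = 1 := prod_mul_self_eq_one fun i => he _ _
    rw [hE] at h1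
    calc coordTuple j vQ w ((Ψ j vQ).symm t)
        = ((∏ i, e (τ i) (w i).1) * ∏ i, e (τ i) (w i).1) * coordTuple j vQ w ((Ψ j vQ).symm t) := by rw [hEE, one_mul]
      _ = (∏ i, e (τ i) (w i).1) * coordTuple j vQ (fun i => w (τ.symm i)) t := by rw [mul_assoc, ← h1]

/-! ## 2. The (Ind2)-family negating one summand of the tensor factor `0` -/

open scoped Classical in
/-- **The (Ind2)-family acting by `−1` on the direct summand `x` of the tensor factor `0`** (and by `+1` on every other summand of every
factor, in every packet): «independent copies of Ism» on the direct summands, [IUTchIII] Thm. 3.11 (i) (Ind2) p. 154, with Ism ∋ −1 in the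
sign shells. MODEL DATA on the frozen carrier. [claim: Mochizuki2012, status: disputed] -/
def negSummandFamily (x : T.V) : (NaiveProv.signShells T).PacketAut := fun j vQ =>
  (NaiveProv.signShells T).factorwise j vQ fun i => (NaiveProv.signShells T).summandwise vQ fun u =>
    if i = 0 ∧ u.1 = x then LinearEquiv.neg ℚ else LinearEquiv.refl ℚ ℚ

/-- `negSummandFamily x` IS an (Ind2)-family of the frozen carrier. [folklore] -/
theorem negSummandFamily_mem_Ind2Family (x : T.V) :
    (negSummandFamily x : (NaiveProv.signShells T).PacketAut) ∈ (NaiveProv.signShells T).Ind2Family := by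
  classical
  intro j vQ
  refine ⟨fun i u => if i = 0 ∧ u.1 = x then LinearEquiv.neg ℚ else LinearEquiv.refl ℚ ℚ, fun i u => ?_, rfl⟩
  show (if i = 0 ∧ u.1 = x then LinearEquiv.neg ℚ else LinearEquiv.refl ℚ ℚ) ∈ Cor312.IdentifiedNonVacuity.signs
  unfold Cor312.IdentifiedNonVacuity.signs
  split_ifs
  · exact Set.mem_insert_of_mem _ (Set.mem_singleton _)
  · exact Set.mem_insert _ _

/-- `negSummandFamily x` lies in the indeterminacy group ⟨(Ind1)∪(Ind2)⟩. [folklore] -/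
theorem negSummandFamily_mem_closure (x : T.V) :
    (negSummandFamily x : (NaiveProv.signShells T).PacketAut) ∈
      Subgroup.closure ((NaiveProv.signShells T).Ind1Family ∪ (NaiveProv.signShells T).Ind2Family) :=
  Subgroup.subset_closure (Or.inr (negSummandFamily_mem_Ind2Family x))

open scoped Classical in
/-- On tuple coordinates `negSummandFamily x` is the sign `−1` exactly when the factor `0` is read at the place `x`. [folklore] -/
theorem coordTuple_negSummandFamily (x : T.V) (j : T.Label) (vQ : T.VQ) (w : T.Caps j → T.Fibre vQ)
    (t : (NaiveProv.signShells T).Packet j vQ) :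
    coordTuple j vQ w (negSummandFamily x j vQ t) = (if (w 0).1 = x then -1 else 1) * coordTuple j vQ w t := by
  refine eq_mul_of_tprod ((coordTuple j vQ w).comp (negSummandFamily x j vQ).toLinearMap) (coordTuple j vQ w) _
    (fun y => ?_) t
  have hg : ∀ (i : T.Caps j) (u : T.Fibre vQ) (z : ℚ),
      (if i = 0 ∧ u.1 = x then LinearEquiv.neg ℚ else LinearEquiv.refl ℚ ℚ) z = (if i = 0 ∧ u.1 = x then -1 else 1) * z := by
    intro i u z
    split_ifs <;> simp
  show coordTuple j vQ w (negSummandFamily x j vQ ((NaiveProv.signShells T).tprod j vQ y)) =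
    (if (w 0).1 = x then -1 else 1) * coordTuple j vQ w (PiTensorProduct.tprod ℚ y)
  unfold negSummandFamily
  rw [LogShells.factorwise_summandwise_tprod]
  show coordTuple j vQ w (PiTensorProduct.tprod ℚ fun i u =>
    (if i = 0 ∧ u.1 = x then LinearEquiv.neg ℚ else LinearEquiv.refl ℚ ℚ) (y i u)) = _
  rw [coordTuple_tprod, coordTuple_tprod]
  simp_rw [hg]
  rw [Finset.prod_mul_distrib, Finset.prod_eq_single (0 : T.Caps j) (fun i _ hi => if_neg fun h => hi h.1)
    (fun h => absurd (Finset.mem_univ _) h)]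
  simp

open scoped Classical in
/-- `negSummandFamily x` PRESERVES the sub-packet of a one-factor theta vector: its `α = j` factor stays supported on the summand `v`.
[folklore] -/
theorem negSummandFamily_thetaVec1_mem_subPacket (p : ℕ) (x v : T.V) (j : T.Label) :
    negSummandFamily x j (T.over v) (NaiveProv.thetaVec1 p v j) ∈ (NaiveProv.signShells T).SubPacket j v := by
  unfold negSummandFamily NaiveProv.thetaVec1
  rw [show PiTensorProduct.tprod ℚ _ = (NaiveProv.signShells T).tprod j (T.over v) _ from rfl,
    LogShells.factorwise_summandwise_tprod]
  refine Submodule.subset_span ⟨_, fun w hw => ?_, rfl⟩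
  have hne : w ≠ T.toFibre v := fun h => hw (by rw [h]; rfl)
  simp [hne]

/-! ## 3. The one computation: sign ratio between two summands of the factor `0` -/

/-- The `j`-component of an element of `Ψ_u` is `s · θ_{u,j}` with `s = ±1`. [folklore] -/
theorem exists_smul_of_mem_PsiOf (p : ℕ) {u : T.V} {f : (NaiveProv.signShells T).StarPacket u}
    (hf : f ∈ NaiveProv.PsiOf (NaiveProv.thetaVec1 p) u) (j : T.LabelStar) :
    ∃ s : ℚ, s * s = 1 ∧ f j = s • NaiveProv.thetaVec1 p u j.1 := by
  rcases hf j with h | h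
  · exact ⟨1, one_mul 1, by rw [h, one_smul]⟩
  · exact ⟨-1, by norm_num, by rw [h, neg_one_smul]⟩

open scoped Classical in
/-- **Sign ratio.** In the packet `(j, v_ℚ(u))`, `j ∈ 𝔽_l^⋆`, let `Φ` act with separable signs `(τ, e)` and carry
`±θ_{u,j}` to `t₀`; read `t₀` along «factor 0 at `b`, all other factors at `u`» (`c_b·q^{j²}`, `c_b ≠ 0`) and along «all factors at `u`»
(`c_a·q^{j²}`). Then `e 0 b · c_a = e 0 u · c_b`. [folklore] -/
theorem sign_ratio (p : ℕ) [hp : Fact p.Prime] {Φ : (NaiveProv.signShells T).PacketAut} {u : T.V}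
    (b : T.Fibre (T.over u)) (hb : b ≠ T.toFibre u) (j : T.LabelStar)
    {τ : Equiv.Perm (T.Caps j.1)} {e : T.Caps j.1 → T.V → ℚ}
    (hτe : ∀ (w : T.Caps j.1 → T.Fibre (T.over u)) t, coordTuple j.1 (T.over u) w (Φ j.1 (T.over u) t) =
      (∏ i, e i (w i).1) * coordTuple j.1 (T.over u) (fun i => w (τ i)) t)
    {f : (NaiveProv.signShells T).StarPacket u} (hf : f ∈ NaiveProv.PsiOf (NaiveProv.thetaVec1 p) u)
    {t₀ : (NaiveProv.signShells T).Packet j.1 (T.over u)} (ht : Φ j.1 (T.over u) (f j) = t₀)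
    {cb ca : ℚ} (hcb0 : cb ≠ 0)
    (hcb : coordTuple j.1 (T.over u) (fun i => if i = 0 then b else T.toFibre u) t₀ = cb * (p : ℚ) ^ ((j.1 : ℕ) ^ 2))
    (hca : coordTuple j.1 (T.over u) (fun _ => T.toFibre u) t₀ = ca * (p : ℚ) ^ ((j.1 : ℕ) ^ 2)) :
    e 0 b.1 * ca = e 0 u * cb := by
  obtain ⟨s, hss, hfj⟩ := exists_smul_of_mem_PsiOf p hf j
  have hP : (p : ℚ) ^ ((j.1 : ℕ) ^ 2) ≠ 0 := pow_ne_zero _ (Nat.cast_ne_zero.mpr hp.out.ne_zero)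
  set wb : T.Caps j.1 → T.Fibre (T.over u) := fun i => if i = 0 then b else T.toFibre u with hwb
  have h1 := hτe wb (f j)
  have h2 := hτe (fun _ => T.toFibre u) (f j)
  rw [ht, hcb, hfj, map_smul, smul_eq_mul, coordTuple_thetaVec1] at h1
  rw [ht, hca, hfj, map_smul, smul_eq_mul, coordTuple_thetaVec1, if_pos rfl] at h2
  -- the permutation must keep `α = j` away from `0`, else `c_b·q^{j²} = 0`
  have hτ0 : τ (T.selfIndex j.1) ≠ 0 := by
    intro h0
    rw [if_neg (by rw [h0]; simpa [wb] using hb), mul_zero, mul_zero] at h1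
    exact (mul_ne_zero hcb0 hP) h1
  rw [if_pos (by simp [wb, hτ0])] at h1
  -- split off the factor `0` of the sign products
  have hsplit : ∀ w : T.Caps j.1 → T.Fibre (T.over u),
      (∏ i, e i (w i).1) = e 0 (w 0).1 * ∏ i ∈ Finset.univ.erase 0, e i (w i).1 := fun w =>
    (Finset.mul_prod_erase Finset.univ (fun i => e i (w i).1) (Finset.mem_univ 0)).symm
  have hrest : (∏ i ∈ Finset.univ.erase (0 : T.Caps j.1), e i (wb i).1) =
      ∏ i ∈ Finset.univ.erase (0 : T.Caps j.1), e i u :=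
    Finset.prod_congr rfl fun i hi => by
      have hi0 : i ≠ 0 := Finset.ne_of_mem_erase hi
      simp [wb, hi0, ThetaIndex.toFibre]
  rw [hsplit, hrest] at h1
  rw [hsplit] at h2
  have hb0 : (wb 0).1 = b.1 := by simp [wb]
  rw [hb0] at h1
  have hu0 : ((fun _ : T.Caps j.1 => T.toFibre u) 0).1 = u := rfl
  rw [hu0] at h2
  set R := ∏ i ∈ Finset.univ.erase (0 : T.Caps j.1), e i u
  -- cancel `q^{j²}`
  have h1' : cb = e 0 b.1 * R * s := mul_right_cancel₀ hP (by rw [h1]; ring)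
  have h2' : ca = e 0 u * R * s := mul_right_cancel₀ hP (by rw [h2]; ring)
  rw [h1', h2']
  ring

end Summit.ABC.IUTFork.Charitable

end
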